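import Literature.Claims.NS.ClayPeriodicPressureBridge
import Literature.Analysis.FunctionSpaces.TorusClassicalNSHorizonPatching
import Literature.Analysis.FunctionSpaces.FlatTorusProofs
import Literature.Analysis.FluidPDE.ClassicalSolutionTorusProofs
import Literature.Analysis.FluidPDE.TaoClassGlobal
import HarnessLib

/-!
# Clay (B)/(D) reference — the TIME-HORIZON axis: «a smooth periodic solution on `[0, T)` for
# every `T`» is EQUIVALENT to Fefferman's «smooth on `[0, ∞)`»

Companion to `Literature/Claims/NS/ClayVariants.lean` (the «wrong problem» reference of the D-0090
NS-claims map; Δ-axis Δ7 QUANTIFIERS (ν, t), time-horizon row) in the same namespace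
`Literature.Claims.NS.ClayVariants`, after `ClayPeriodicPressureBridge` (Δ5, pressure periodic) and
`ClayPeriodScalingBridge` (Δ1, period `L`). Many periodic regularity texts conclude «for every
`T > 0` the solution is smooth on `[0, T)` (or `[0, T]`)», and many periodic blow-up texts produce an
obstruction on ONE finite horizon. This file makes both phrasings kernel-equivalent to the printed
Clay statements, so that neither is by itself a «wrong problem (Δ7 horizon)» delta:

* `torus_descend_of_periodic`, `periodic_lift_of_torus` — transfer between classical solutions of
  the unforced system on `ℝ³ × S` with `ℤ³`-periodic velocity AND pressure slices and classical
  solutions on `𝕋³ × S` (tree bridges `IsClassicalNSSolutionOn.to_torus_holds` / `of_torus_holds`,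
  `Torus.lift_descend_holds`);
* `clayPeriodicErrata_solvable_zero_iff_forall_Ico` — for `ν ≥ 0` and any datum `u₀`:
  errata-class Clay solvability (`u`, `p` smooth on `ℝ³ × [0,∞)`, both periodic, `f ≡ 0`) ⇔ for
  every `T > 0` a classical solution on `[0, T)` with `u(0) = u₀` and `u(·,t)`, `p(·,t)` periodic
  (patching on the torus: `Torus.IsClassicalNSSolutionOn.exists_Ici_of_forall_Ico`, uniqueness
  Majda–Bertozzi Cor. 3.1 + locality);
* `clayPeriodic_solvable_zero_iff_forall_Ico` — the same for the PRINTED class (10) (velocity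
  periodic, pressure free), finite-horizon solutions being pressure-normalised first
  (`IsClassicalNSSolutionOn.exists_pressurePeriodic_of_velocityPeriodic_Ico_zero`, Tao 2013 L4.1(ii));
  `clayPeriodic_solvable_zero_iff_forall_Icc` — closed slabs `[0, T]`;
* `clayPeriodic_regularityAt_iff_forall_horizon`, `navierStokesExistenceSmoothPeriodic_iff_forall_horizon`
  — (B) at one `ν > 0`, resp. the leaf `NavierStokesExistenceSmoothPeriodic`, ⇔ «every smooth
  divergence-free periodic datum has, for every `T > 0`, a classical velocity-periodic solution on
  `[0, T)`»;
* `navierStokesBreakdownPeriodic_of_not_solvable_Ico`,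
  `navierStokesBreakdownPeriodicPressurePeriodic_of_not_solvable_Ico` — an UNFORCED periodic datum
  at ONE viscosity with NO classical velocity-periodic (resp. `u`,`p`-periodic) solution on SOME
  finite horizon `[0, T)` proves printed (D) (resp. errata (D)).

Usage on a CARD (§3 Clay delta, axis Δ7 horizon): a (B)-type claim proved «on `[0,T)` for all `T`»
composes with `clayPeriodic_solvable_zero_iff_forall_Ico` / `…regularityAt_iff_forall_horizon` —
no delta; a (D)-type claim exhibiting a finite-horizon obstruction composes with
`navierStokesBreakdownPeriodic_of_not_solvable_Ico`. What remains printed-only on this axis: local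
existence itself (Clay PDF p. 2 «it is known that (A) and (B) hold … if the time interval `[0,∞)`
is replaced by a small time interval `[0,T)`», a «wrong problem (Δ6)» when claimed as the result).

## References

* C. L. Fefferman, *Existence and smoothness of the Navier–Stokes equation*, CMI 2006, (B), (D),
  (8)–(11) p. 2; errata p. 6. [FeffermanClay2006]
* T. Tao, *Localisation and compactness properties of the Navier–Stokes global regularity problem*,
  Anal. PDE 6 (2013), Lemma 4.1 (ii), §3. [Tao2013Localisation]
* J. C. Robinson, J. L. Rodrigo, W. Sadowski, CUP 2016, §8.1; A. J. Majda, A. L. Bertozzi, CUP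
  2002, Cor. 3.1. [RobinsonRodrigoSadowskiCUP2016] [MajdaBertozziCUP2002]

WHAT THIS IS NOT: not a claim about NS regularity or blow-up; not a claim about any author beyond
the typed locator.
-/

noncomputable section

open Set
open scoped ContDiff

namespace Literature.Claims.NS.ClayVariants

open Literature.Analysis Literature.Analysis.FluidPDE Literature.Analysis.FunctionSpaces

/-! ## Transfer `ℝ³`-periodic ↔ `𝕋³` for classical solutions of the unforced system -/

section Transfer

variable {S : Set ℝ} {ν : ℝ}

/-- **Descent.** A classical solution of the unforced Navier–Stokes system on `ℝ³ × S` whose velocity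
and pressure slices are `ℤ³`-periodic for `t ∈ S` is, read through `Torus.repr`, a classical
solution on `𝕋³ × S`, and its velocity slices are the lifts of the descended ones
(`IsClassicalNSSolutionOn.to_torus_holds` after `congr_slices` / `Torus.lift_descend_holds`).
[cite: FeffermanClay2006, (8) (10) (11) p. 2] -/
theorem torus_descend_of_periodic
    {u : ℝ → EuclideanSpace ℝ (Fin 3) → EuclideanSpace ℝ (Fin 3)} {p : ℝ → EuclideanSpace ℝ (Fin 3) → ℝ}
    (hcl : IsClassicalNSSolutionOn S ν 0 u p)
    (hper : ∀ t ∈ S, IsLatticePeriodic (u t) ∧ IsLatticePeriodic (p t)) :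
    Torus.IsClassicalNSSolutionOn S ν 0 (fun t x => u t (Torus.repr x)) (fun t x => p t (Torus.repr x)) ∧
      ∀ t ∈ S, Torus.lift (fun x => u t (Torus.repr x)) = u t := by
  have hvU : ∀ t ∈ S, (fun s => Torus.lift (fun x => u s (Torus.repr x))) t = u t := fun t ht =>
    Torus.lift_descend_holds (u t) (hper t ht).1
  have hqP : ∀ t ∈ S, (fun s => Torus.lift (fun x => p s (Torus.repr x))) t = p t := fun t ht =>
    Torus.lift_descend_holds (p t) (hper t ht).2
  have hcl' : IsClassicalNSSolutionOn S ν
      (fun t => Torus.lift ((0 : ℝ → UnitAddTorus (Fin 3) → EuclideanSpace ℝ (Fin 3)) t))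
      (fun t => Torus.lift (fun x => u t (Torus.repr x)))
      (fun t => Torus.lift (fun x => p t (Torus.repr x))) := by
    have h0 : (fun t => Torus.lift ((0 : ℝ → UnitAddTorus (Fin 3) → EuclideanSpace ℝ (Fin 3)) t)) =
        (0 : ℝ → EuclideanSpace ℝ (Fin 3) → EuclideanSpace ℝ (Fin 3)) := rfl
    rw [h0]
    exact hcl.congr_slices hvU hqP
  exact ⟨IsClassicalNSSolutionOn.to_torus_holds hcl', hvU⟩

/-- **Lift.** A classical solution of the unforced system on `𝕋³ × S` lifts to a classical solution
on `ℝ³ × S` with `ℤ³`-periodic velocity and pressure slices (`IsClassicalNSSolutionOn.of_torus_holds`,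
`Torus.isLatticePeriodic_lift`). [cite: FeffermanClay2006, (8) (10) (11) p. 2] -/
theorem periodic_lift_of_torus
    {U : ℝ → UnitAddTorus (Fin 3) → EuclideanSpace ℝ (Fin 3)} {P : ℝ → UnitAddTorus (Fin 3) → ℝ}
    (h : Torus.IsClassicalNSSolutionOn S ν 0 U P) :
    IsClassicalNSSolutionOn S ν 0 (fun t => Torus.lift (U t)) (fun t => Torus.lift (P t)) ∧
      ∀ t, IsLatticePeriodic (Torus.lift (U t)) ∧ IsLatticePeriodic (Torus.lift (P t)) := by
  have h' := IsClassicalNSSolutionOn.of_torus_holds h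
  have h0 : (fun t => Torus.lift ((0 : ℝ → UnitAddTorus (Fin 3) → EuclideanSpace ℝ (Fin 3)) t)) =
      (0 : ℝ → EuclideanSpace ℝ (Fin 3) → EuclideanSpace ℝ (Fin 3)) := rfl
  rw [h0] at h'
  exact ⟨h', fun t => ⟨Torus.isLatticePeriodic_lift _, Torus.isLatticePeriodic_lift _⟩⟩

end Transfer

/-! ## Solvability of one Cauchy problem: `[0, ∞)` ⇔ every `[0, T)` -/

section Solvable

variable {ν : ℝ}

/-- **Errata-class Clay solvability ⇔ classical solvability on every finite horizon, `u` and `p`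
periodic** (`ν ≥ 0`, `f ≡ 0`, any datum `u₀`): (⇒) restrict the global solution
(`isNavierStokesSolution_and_smooth_iff`, `mono`); (⇐) descend each finite-horizon solution to
`𝕋³`, patch them by uniqueness (`Torus.IsClassicalNSSolutionOn.exists_Ici_of_forall_Ico`), lift
back — the datum is recovered because it is periodic (`Torus.lift_descend_holds`).
[cite: FeffermanClay2006, (B) with (8) (10) (11) p. 2 and errata p. 6] [cite: RobinsonRodrigoSadowskiCUP2016, §8.1] -/
theorem clayPeriodicErrata_solvable_zero_iff_forall_Ico (hν : 0 ≤ ν)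
    (u₀ : EuclideanSpace ℝ (Fin 3) → EuclideanSpace ℝ (Fin 3)) :
    clayPeriodicErrata.Solvable ν 0 u₀ ↔
      ∀ T : ℝ, 0 < T →
        ∃ (u : ℝ → EuclideanSpace ℝ (Fin 3) → EuclideanSpace ℝ (Fin 3))
          (p : ℝ → EuclideanSpace ℝ (Fin 3) → ℝ),
          IsClassicalNSSolutionOn (Ico 0 T) ν 0 u p ∧ u 0 = u₀ ∧
            ∀ t ∈ Ico 0 T, IsLatticePeriodic (u t) ∧ IsLatticePeriodic (p t) := by
  constructor
  · rintro ⟨u, p, hu, hp, hns, hadm⟩ T _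
    have hcl := isNavierStokesSolution_and_smooth_iff.1 ⟨hns, hu, hp⟩
    exact ⟨u, p, hcl.1.mono Ico_subset_Ici_self (uniqueDiffOn_Ico 0 T), hcl.2,
      fun t ht => hadm t ht.1⟩
  · intro h
    -- the datum is periodic (it is the time-0 slice of the horizon-1 solution)
    have hu₀per : IsLatticePeriodic u₀ := by
      obtain ⟨u, p, -, h0, hper⟩ := h 1 one_pos
      rw [← h0]
      exact (hper 0 ⟨le_rfl, one_pos⟩).1
    -- descend every finite-horizon solution to the torus
    have hT : ∀ T : ℝ, 0 < T →
        ∃ (U : ℝ → UnitAddTorus (Fin 3) → EuclideanSpace ℝ (Fin 3)) (P : ℝ → UnitAddTorus (Fin 3) → ℝ),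
          Torus.IsClassicalNSSolutionOn (Ico 0 T) ν 0 U P ∧ U 0 = fun x => u₀ (Torus.repr x) := by
      intro T hT
      obtain ⟨u, p, hcl, h0, hper⟩ := h T hT
      refine ⟨_, _, (torus_descend_of_periodic hcl hper).1, ?_⟩
      funext x
      show u 0 (Torus.repr x) = u₀ (Torus.repr x)
      rw [h0]
    -- patch on the torus and lift back
    obtain ⟨U, P, hUP, hU0, -⟩ := Torus.IsClassicalNSSolutionOn.exists_Ici_of_forall_Ico hν hT 0
    obtain ⟨hlift, hper⟩ := periodic_lift_of_torus hUP
    have h0 : (fun t => Torus.lift (U t)) 0 = u₀ := by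
      show Torus.lift (U 0) = u₀
      rw [hU0]
      exact Torus.lift_descend_holds u₀ hu₀per
    have hns := isNavierStokesSolution_and_smooth_iff.2 ⟨hlift, h0⟩
    exact ⟨_, _, hns.2.1, hns.2.2, hns.1, fun t _ => hper t⟩

/-- **Printed-class Clay solvability ((10): velocity periodic, pressure free) ⇔ classical
solvability on every finite horizon with periodic velocity** (`ν ≥ 0`, `f ≡ 0`): through the errata
class (`clayPeriodic_solvable_zero_iff_errata`, Δ5) after normalising the pressure of each
finite-horizon solution by a Galilean boost fixing the datum
(`IsClassicalNSSolutionOn.exists_pressurePeriodic_of_velocityPeriodic_Ico_zero`).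
[cite: FeffermanClay2006, (B) with (8) (10) (11) p. 2] [cite: Tao2013Localisation, Lemma 4.1 (ii), §3 eq. (galilean)] -/
theorem clayPeriodic_solvable_zero_iff_forall_Ico (hν : 0 ≤ ν)
    (u₀ : EuclideanSpace ℝ (Fin 3) → EuclideanSpace ℝ (Fin 3)) :
    clayPeriodic.Solvable ν 0 u₀ ↔
      ∀ T : ℝ, 0 < T →
        ∃ (u : ℝ → EuclideanSpace ℝ (Fin 3) → EuclideanSpace ℝ (Fin 3))
          (p : ℝ → EuclideanSpace ℝ (Fin 3) → ℝ),
          IsClassicalNSSolutionOn (Ico 0 T) ν 0 u p ∧ u 0 = u₀ ∧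
            ∀ t ∈ Ico 0 T, IsLatticePeriodic (u t) := by
  rw [clayPeriodic_solvable_zero_iff_errata, clayPeriodicErrata_solvable_zero_iff_forall_Ico hν]
  refine forall₂_congr fun T hT => ⟨?_, ?_⟩
  · rintro ⟨u, p, hcl, h0, hper⟩
    exact ⟨u, p, hcl, h0, fun t ht => (hper t ht).1⟩
  · rintro ⟨u, p, hcl, h0, hper⟩
    obtain ⟨v, q, hv, hv0, hper'⟩ := hcl.exists_pressurePeriodic_of_velocityPeriodic_Ico_zero hT hper
    exact ⟨v, q, hv, hv0.trans h0, hper'⟩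

/-- **Closed slabs**: printed-class Clay solvability ⇔ a classical velocity-periodic solution on
`[0, T]` for every `T > 0` (restrict `[0, T+1) ⊇ [0, T]`, resp. `[0, T] ⊇ [0, T)`).
[cite: FeffermanClay2006, (B) with (8) (10) (11) p. 2] -/
theorem clayPeriodic_solvable_zero_iff_forall_Icc (hν : 0 ≤ ν)
    (u₀ : EuclideanSpace ℝ (Fin 3) → EuclideanSpace ℝ (Fin 3)) :
    clayPeriodic.Solvable ν 0 u₀ ↔
      ∀ T : ℝ, 0 < T →
        ∃ (u : ℝ → EuclideanSpace ℝ (Fin 3) → EuclideanSpace ℝ (Fin 3))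
          (p : ℝ → EuclideanSpace ℝ (Fin 3) → ℝ),
          IsClassicalNSSolutionOn (Icc 0 T) ν 0 u p ∧ u 0 = u₀ ∧
            ∀ t ∈ Icc 0 T, IsLatticePeriodic (u t) := by
  rw [clayPeriodic_solvable_zero_iff_forall_Ico hν]
  constructor
  · intro h T hT
    obtain ⟨u, p, hcl, h0, hper⟩ := h (T + 1) (by linarith)
    have hsub : Icc 0 T ⊆ Ico 0 (T + 1) := Icc_subset_Ico_right (by linarith)
    exact ⟨u, p, hcl.mono hsub (uniqueDiffOn_Icc hT), h0, fun t ht => hper t (hsub ht)⟩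
  · intro h T hT
    obtain ⟨u, p, hcl, h0, hper⟩ := h T hT
    exact ⟨u, p, hcl.mono Ico_subset_Icc_self (uniqueDiffOn_Ico 0 T), h0,
      fun t ht => hper t (Ico_subset_Icc_self ht)⟩

end Solvable

/-! ## (B) and (D) in finite-horizon form -/

section Statements

/-- **(B) at one viscosity `μ > 0` in finite-horizon form**: `clayPeriodic.RegularityAt μ` ⇔ every
smooth divergence-free `ℤ³`-periodic datum has, for every `T > 0`, a classical solution of the
unforced system on `ℝ³ × [0, T)` with that datum and periodic velocity slices.
[cite: FeffermanClay2006, (B) with (8) (10) (11) p. 2] -/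
theorem clayPeriodic_regularityAt_iff_forall_horizon {μ : ℝ} (hμ : 0 < μ) :
    clayPeriodic.RegularityAt μ ↔
      ∀ u₀ : EuclideanSpace ℝ (Fin 3) → EuclideanSpace ℝ (Fin 3), ContDiff ℝ ∞ u₀ →
        NSWave0.IsDivFree u₀ → IsLatticePeriodic u₀ →
          ∀ T : ℝ, 0 < T →
            ∃ (u : ℝ → EuclideanSpace ℝ (Fin 3) → EuclideanSpace ℝ (Fin 3))
              (p : ℝ → EuclideanSpace ℝ (Fin 3) → ℝ),
              IsClassicalNSSolutionOn (Ico 0 T) μ 0 u p ∧ u 0 = u₀ ∧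
                ∀ t ∈ Ico 0 T, IsLatticePeriodic (u t) :=
  forall_congr' fun u₀ => forall_congr' fun _ => forall_congr' fun _ => forall_congr' fun _ =>
    clayPeriodic_solvable_zero_iff_forall_Ico hμ.le u₀

/-- **The leaf (B) `NavierStokesExistenceSmoothPeriodic` in finite-horizon form** (all `ν > 0`; via
`clayPeriodic_regularity_iff`, `Iff.rfl`). [cite: FeffermanClay2006, (B) with (8) (10) (11) p. 2] -/
theorem navierStokesExistenceSmoothPeriodic_iff_forall_horizon :
    Summit.NavierStokesRegularity.NavierStokesRegularity.NavierStokesExistenceSmoothPeriodic ↔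
      ∀ ν : ℝ, 0 < ν →
        ∀ u₀ : EuclideanSpace ℝ (Fin 3) → EuclideanSpace ℝ (Fin 3), ContDiff ℝ ∞ u₀ →
          NSWave0.IsDivFree u₀ → IsLatticePeriodic u₀ →
            ∀ T : ℝ, 0 < T →
              ∃ (u : ℝ → EuclideanSpace ℝ (Fin 3) → EuclideanSpace ℝ (Fin 3))
                (p : ℝ → EuclideanSpace ℝ (Fin 3) → ℝ),
                IsClassicalNSSolutionOn (Ico 0 T) ν 0 u p ∧ u 0 = u₀ ∧
                  ∀ t ∈ Ico 0 T, IsLatticePeriodic (u t) := by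
  rw [← clayPeriodic_regularity_iff]
  exact forall₂_congr fun ν hν => clayPeriodic_regularityAt_iff_forall_horizon hν

/-- **An UNFORCED finite-horizon obstruction at ONE viscosity proves printed (D)**: if `μ > 0` and some
smooth divergence-free periodic datum admits, for some `T > 0`, NO classical solution of the unforced
system on `ℝ³ × [0, T)` with periodic velocity slices, then `NavierStokesBreakdownPeriodic`
(through `clayPeriodic_solvable_zero_iff_forall_Ico` and the Δ5/Δ7 bridges
`navierStokesBreakdownPeriodic_of_not_errataSolvable_zero`, `clayPeriodic_solvable_zero_iff_errata`).
[cite: FeffermanClay2006, (D) p. 2] [cite: Tao2013Localisation, Rem. 1.2 footnote and Lemma 4.1 (ii)] -/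
theorem navierStokesBreakdownPeriodic_of_not_solvable_Ico {μ : ℝ} (hμ : 0 < μ)
    {u₀ : EuclideanSpace ℝ (Fin 3) → EuclideanSpace ℝ (Fin 3)} (hu₀ : ContDiff ℝ ∞ u₀)
    (hdiv : NSWave0.IsDivFree u₀) (hper : IsLatticePeriodic u₀) {T : ℝ} (hT : 0 < T)
    (hno : ¬ ∃ (u : ℝ → EuclideanSpace ℝ (Fin 3) → EuclideanSpace ℝ (Fin 3))
        (p : ℝ → EuclideanSpace ℝ (Fin 3) → ℝ),
        IsClassicalNSSolutionOn (Ico 0 T) μ 0 u p ∧ u 0 = u₀ ∧ ∀ t ∈ Ico 0 T, IsLatticePeriodic (u t)) :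
    Summit.NavierStokesRegularity.NavierStokesRegularity.NavierStokesBreakdownPeriodic :=
  navierStokesBreakdownPeriodic_of_not_errataSolvable_zero hμ hu₀ hdiv hper fun hsol =>
    hno (((clayPeriodic_solvable_zero_iff_forall_Ico hμ.le u₀).mp
      ((clayPeriodic_solvable_zero_iff_errata μ u₀).mpr hsol)) T hT)

/-- The same finite-horizon obstruction with `u` AND `p` periodic excluded proves errata-(D)
(`NavierStokesBreakdownPeriodicPressurePeriodic`) — and, the unforced dichotomy being insensitive to
the pressure convention, printed (D) as well (`navierStokesBreakdownPeriodic_of_not_solvable_Ico`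
with the weaker exclusion). [cite: FeffermanClay2006, (D) p. 2 and errata p. 6] -/
theorem navierStokesBreakdownPeriodicPressurePeriodic_of_not_solvable_Ico {μ : ℝ} (hμ : 0 < μ)
    {u₀ : EuclideanSpace ℝ (Fin 3) → EuclideanSpace ℝ (Fin 3)} (hu₀ : ContDiff ℝ ∞ u₀)
    (hdiv : NSWave0.IsDivFree u₀) (hper : IsLatticePeriodic u₀) {T : ℝ} (hT : 0 < T)
    (hno : ¬ ∃ (u : ℝ → EuclideanSpace ℝ (Fin 3) → EuclideanSpace ℝ (Fin 3))
        (p : ℝ → EuclideanSpace ℝ (Fin 3) → ℝ),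
        IsClassicalNSSolutionOn (Ico 0 T) μ 0 u p ∧ u 0 = u₀ ∧
          ∀ t ∈ Ico 0 T, IsLatticePeriodic (u t) ∧ IsLatticePeriodic (p t)) :
    Summit.NavierStokesRegularity.NavierStokesRegularity.NavierStokesBreakdownPeriodicPressurePeriodic :=
  navierStokesBreakdownPeriodicPressurePeriodic_of_not_errataSolvable_zero hμ hu₀ hdiv hper fun hsol =>
    hno (((clayPeriodicErrata_solvable_zero_iff_forall_Ico hμ.le u₀).mp hsol) T hT)

end Statements

end Literature.Claims.NS.ClayVariants

end

-- WHAT THIS IS NOT: not a claim about NS regularity or blow-up; not a claim about any author beyond the typed locator.
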